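import Literature.Computability.AlgebraicComplexity.Kron444HullCheck
import HarnessLib

/-!
# `Kron(4,4,4) ⊆ conv(328 vertices)`: certificate checks, part 6/14

Proofs file (computations only): the node checks of `Kron444HullCheck.lean` for the chunks
70 … 80 of the certificate, each decided by the kernel (`decide +kernel`; `maxHeartbeats 0`:
a chunk is ≈ 10⁵–10⁶ kernel reductions). Assembled in `Kron444Hull.lean`. [folklore]
-/

set_option Elab.async false

namespace Literature.Computability.AlgebraicComplexity.Kron444Hull

/-- Nodes `1750 … 1774` of the certificate (chunk `70`) pass `checkNodeRec`. [folklore] -/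
theorem checkChunk_70 : checkChunk 70 25 = true := by
  set_option maxHeartbeats 0 in decide +kernel

/-- Nodes `1775 … 1799` of the certificate (chunk `71`) pass `checkNodeRec`. [folklore] -/
theorem checkChunk_71 : checkChunk 71 25 = true := by
  set_option maxHeartbeats 0 in decide +kernel

/-- Nodes `1800 … 1824` of the certificate (chunk `72`) pass `checkNodeRec`. [folklore] -/
theorem checkChunk_72 : checkChunk 72 25 = true := by
  set_option maxHeartbeats 0 in decide +kernel

/-- Nodes `1825 … 1849` of the certificate (chunk `73`) pass `checkNodeRec`. [folklore] -/
theorem checkChunk_73 : checkChunk 73 25 = true := by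
  set_option maxHeartbeats 0 in decide +kernel

/-- Nodes `1850 … 1874` of the certificate (chunk `74`) pass `checkNodeRec`. [folklore] -/
theorem checkChunk_74 : checkChunk 74 25 = true := by
  set_option maxHeartbeats 0 in decide +kernel

/-- Nodes `1875 … 1899` of the certificate (chunk `75`) pass `checkNodeRec`. [folklore] -/
theorem checkChunk_75 : checkChunk 75 25 = true := by
  set_option maxHeartbeats 0 in decide +kernel

/-- Nodes `1900 … 1924` of the certificate (chunk `76`) pass `checkNodeRec`. [folklore] -/
theorem checkChunk_76 : checkChunk 76 25 = true := by
  set_option maxHeartbeats 0 in decide +kernel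

/-- Nodes `1925 … 1949` of the certificate (chunk `77`) pass `checkNodeRec`. [folklore] -/
theorem checkChunk_77 : checkChunk 77 25 = true := by
  set_option maxHeartbeats 0 in decide +kernel

/-- Nodes `1950 … 1974` of the certificate (chunk `78`) pass `checkNodeRec`. [folklore] -/
theorem checkChunk_78 : checkChunk 78 25 = true := by
  set_option maxHeartbeats 0 in decide +kernel

/-- Nodes `1975 … 1999` of the certificate (chunk `79`) pass `checkNodeRec`. [folklore] -/
theorem checkChunk_79 : checkChunk 79 25 = true := by
  set_option maxHeartbeats 0 in decide +kernel

/-- Nodes `2000 … 2024` of the certificate (chunk `80`) pass `checkNodeRec`. [folklore] -/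
theorem checkChunk_80 : checkChunk 80 25 = true := by
  set_option maxHeartbeats 0 in decide +kernel

end Literature.Computability.AlgebraicComplexity.Kron444Hull
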